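import Summits.BirchSwinnertonDyer.BirchSwinnertonDyer.Theorems.QuadraticBranchSignedControlPlusKatoDivisibilityEtaContraOfNamedFacts
import Summits.BirchSwinnertonDyer.Rank1Residual.Additive.QuadraticBranchPlusKatoDivisibilityIota
import HarnessLib

/-!
# K8, Kato side PRINT-EXACT on the tree's duals: (RK⁺)^ι `Char X⁺(V/ℚ_∞)·(ι L_p⁺(V,η,X)) ⊆ Char X⁺(V/F_∞)` row by row on the
# tower-onto Gss2 rows, from `{hZ′ (p608027), Q73′ (p600084), h12}` + the proved descent frame — no functional equation

Cell `bsd-potss` (HOME `run/shared/lean/pub/bsd-potss/`), seat `bsd-potss-k8q-c2x` g10 (prover; lane B of the K8 Kato side,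
route `QuadraticBranchSignedControl`), duty T-Q73ι-2 «K8-IOTA» (planner g27, kit `plan/rekey-20445-g27/`, work order S2).
HONEST FRAMING: THEOREMS ONLY — no definition, no named fact, no instance, no `sorry`; closes no item by itself; the named-fact
inputs are displayed as hypotheses — `hZc` = `Kobayashi2003.thm62_63_73_etaColemanPoitouTate_zeta_contra` (p608027), `h134c` =
`Kato2004.thm13_4_lengthAt_fineSelmerDualContra_le_of_isEulerSystemClass` (p600084), `h12` =
`Kobayashi2003.thm12_signedSelmerDual_finite_torsion`; nothing of Kato/Kobayashi is proved here; BSD is not proved by any of this.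

## What

**`quadraticBranchPlusKatoDivisibilityIota_row_of_zetaContra_of_thm13_4Contra_of_thm12`** — for ONE globally minimal `V/ℚ`,
`p ≥ 5` good with `a_p = 0` and `ρ̄_{V,p^m}` onto for all `m`, and every admissible `ℚ(√p*)`-model / cyclotomic frame / branch
function / pair of dual data (the binders of `Additive.QuadraticBranchPlusKatoDivisibilityIotaAt V p`, p609986, its body SPELLED
OUT), `X⁺(V/F_∞)` is
finitely generated `Λ`-torsion and `pⁿ · Char X⁺(V/ℚ_∞) · (ι Lη) ⊆ Char X⁺(V/F_∞)`, `n = 0` on the onto rows. Road: the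
decomposition `X⁺(V/F_∞) ≅ X⁺(V/ℚ_∞) ⊕ X⁺(V/K_∞)^η` over the PROVED frame `etaDescentFrame_proof`
(`exists_etaDatum_prod_linearEquiv_of_decomposition`), `h12` for `X⁺(V/ℚ_∞)`, `KatoSideIotaContra.etaKatoDivisibilityInvol_…`
for the `η`-part ((v) for `V^{(p*)}` automatic on onto rows, (12.5.2)), multiplicativity of `Char`. The §4 analogue of
`KatoSideOnto.…_of_facts_of_onto` (p553368) with `Lη ↦ ι Lη` and the print-exact inputs. Then **THE BY-NAME PRODUCER
`plusKatoDivisibilityBranchOntoIota_ofNamedFactsContra : hZ′ → Q73′ → h12 → ∀ V p, 5 ≤ p → good → a_p = 0 → (∀ m, onto p^m) →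
Additive.QuadraticBranchPlusKatoDivisibilityIotaAt V p`** — literally the planner's `ProducerUnfolded` (kit sketch S2c), i.e. the
unfolded glue `PlusKatoDivisibilityBranchOntoIotaOfNamedFactsContra` of the re-keyed crux `PlusKatoDivisibilityBranchOntoIota`.
NOT Theses-free (and cannot be: the frame is typed by the route decl `EtaDescentFrame`), so the split's glue closes by a Theorems
one-liner over this producer (21365 pattern), not by `--glue-by`.

References: [Kobayashi2003] Thm. 1.2 (p. 2), Thm. 2.2 (p. 5), Thm. 4.1 (p. 8), last sentence of §7 (p. 13); [Kato2004Asterisque]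
(12.5.2) (p. 222), Thm. 13.4 (p. 226); [GreenbergLNM1716] §3 (descent; reading).
-/

noncomputable section

-- justification: the `Summit.BirchSwinnertonDyer.BirchSwinnertonDyer.…` path repeats a component (route-file convention)
set_option linter.dupNamespace false
set_option autoImplicit false

open scoped Classical

namespace Summit.BirchSwinnertonDyer.BirchSwinnertonDyer.Theorems

namespace KatoSideIotaContra

open CongruenceSubgroup Field WeierstrassCurve
open Literature.NumberTheory.EllipticCurves
open Literature.NumberTheory.EllipticCurves.ModularForms
open Literature.NumberTheory.EllipticCurves.Module
open Literature.NumberTheory.GaloisRepresentations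
open Summit.BirchSwinnertonDyer.Rank1Residual.Additive hiding EtaSignedSelmerDualData
open Summit.BirchSwinnertonDyer.Rank1Residual.Additive.SignedTwist
open Summit.BirchSwinnertonDyer.BirchSwinnertonDyer.Theses.QuadraticBranchSignedControl
open SignedKatoOffTwo.IwasawaInvolution

section Row

variable {p : ℕ} [Fact p.Prime]

/-! ## §1 (RK⁺)^ι for ONE tower-onto curve from `{hZ′, Q73′, h12}` + the proved descent frame (conclusion spelled out) -/

/-- **(RK⁺)^ι — `Additive.QuadraticBranchPlusKatoDivisibilityIotaAt V p` SPELLED OUT — for ONE tower-onto curve from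
`{hZ′, Q73′, h12}` + the PROVED descent frame `etaDescentFrame_proof`** ((v) for `V^{(p*)}` is automatic there: `√p* ∈ ℚ(ζ_p)`,
(12.5.2)): for every admissible `ℚ(√p*)`-model, `X⁺(V/F_∞)` is finitely generated `Λ`-torsion and
`pⁿ · Char X⁺(V/ℚ_∞) · (ι Lη) ⊆ Char X⁺(V/F_∞)` (`n = 0` on the onto rows) — the decomposition
`X⁺(V/F_∞) ≅ X⁺(V/ℚ_∞) ⊕ X⁺(V/K_∞)^η` (`exists_etaDatum_prod_linearEquiv_of_decomposition`), `h12` for `X⁺(V/ℚ_∞)`, §5 for the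
`η`-part, multiplicativity of `Char`. Print-exact on the tree's duals; no functional equation. The §4 analogue of
`KatoSideOnto.…_of_facts_of_onto` with `Lη ↦ ι Lη`. [cite: Kobayashi2003, Thm. 1.2 (p. 2), Thm. 2.2 (p. 5), Thm. 4.1 (p. 8)]
[cite: Kato2004Asterisque, (12.5.2) (p. 222), Thm. 13.4 (p. 226)] [cite: GreenbergLNM1716, §3 (descent; reading)] -/
theorem quadraticBranchPlusKatoDivisibilityIota_row_of_zetaContra_of_thm13_4Contra_of_thm12
    (hZc : Kobayashi2003.thm62_63_73_etaColemanPoitouTate_zeta_contra)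
    (h134c : Kato2004.thm13_4_lengthAt_fineSelmerDualContra_le_of_isEulerSystemClass)
    (h12 : Kobayashi2003.thm12_signedSelmerDual_finite_torsion)
    (V : WeierstrassCurve ℚ) [V.IsElliptic] [V.IsGloballyMinimal] (hp5 : 5 ≤ p)
    (hgood : V.HasGoodReductionAtPrime p) (hap : V.frobeniusTrace p = 0)
    (hsurj : ∀ m : ℕ, V.HasSurjectiveModNGaloisRep (p ^ m : ℕ))
    (F : Type) [Field F] [NumberField F] (V' : WeierstrassCurve F) [V'.IsElliptic]
    {κ : ZpExtension ℚ p} {γ : Field.absoluteGaloisGroup ℚ}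
    {κF : ZpExtension F p} {γF : Field.absoluteGaloisGroup F}
    {N : ℕ} [NeZero N] {f : CuspForm (Gamma0 N) 2}
    (hF : Module.finrank ℚ F = 2) (hθ : ∃ θ : F, θ ^ 2 = algebraMap ℚ F ((-1) ^ (p / 2) * p))
    (hC : ∃ C : VariableChange F, C • V.baseChange F = V')
    (hκ : κ.IsCyclotomic) (hγ : κ.IsTopGenerator γ) (hγc : IsCyclotomicVariable p γ)
    (hκF : κF.IsCyclotomic) (hγF : κF.IsTopGenerator γF)
    (hζ : ∃ ζ : ℤ_[p]ˣ, IsOfFinOrder ζ ∧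
      ((GaloisRep.cyclotomicCharacter F p γF * ζ : ℤ_[p]ˣ) : ℤ_[p]) =
        (cyclotomicGenerator p : ℤ_[p]))
    (hf : IsNewformOf V f) (ϖ : ℚ)
    (hϖ : if Even (p / 2) then (ϖ : ℝ) * V.realPeriodRat = plusPeriod f
        else (ϖ : ℝ) * V.imaginaryPeriodRat = minusPeriod f)
    (Lη : IwasawaAlgebra p)
    (hL : Summit.BirchSwinnertonDyer.Rank1Residual.Additive.IsQuadraticBranchPlusLFunction f p ϖ Lη)
    (D : Kobayashi2003.SignedSelmerDualData V κ γ 1) (DF : Kobayashi2003.SignedSelmerDualData V' κF γF 1) :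
    Module.Finite (IwasawaAlgebra p) DF.X ∧ Module.IsTorsion (IwasawaAlgebra p) DF.X ∧
      (∃ n : ℕ, Ideal.span {(p : IwasawaAlgebra p) ^ n} *
          (D.charIdeal * Ideal.span {IwasawaAlgebra.invol p Lη}) ≤ DF.charIdeal) ∧
      ((∀ m : ℕ, V.HasSurjectiveModNGaloisRep (p ^ m : ℕ)) →
        D.charIdeal * Ideal.span {IwasawaAlgebra.invol p Lη} ≤ DF.charIdeal) := by
  have hp2 : p ≠ 2 := by omega
  have hc : (((-1 : ℚ) ^ (p / 2)) * p) ≠ 0 :=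
    mul_ne_zero (pow_ne_zero _ (by norm_num)) (Nat.cast_ne_zero.mpr (Fact.out : p.Prime).ne_zero)
  have hv : ∀ [(V.quadraticTwist (((-1 : ℚ) ^ (p / 2)) * p)).IsElliptic],
      ∃ σ : absoluteGaloisGroup ℚ,
        (∀ (n : ℕ) (t : AlgebraicClosure ℚ), t ^ p ^ n = 1 → σ • t = t) ∧
          Module.finrank ℤ_[p]
            (((V.quadraticTwist (((-1 : ℚ) ^ (p / 2)) * p)).tateModule p) ⧸
              LinearMap.range
                ((V.quadraticTwist (((-1 : ℚ) ^ (p / 2)) * p)).galoisRepTate p σ - 1)) = 1 := by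
    intro _
    obtain ⟨C, hC⟩ := exists_variableChange_twist_twist V hc
    exact Kato2004.exists_finrank_coker_eq_one_of_smul_eq_quadraticTwist_primeStar_of_forall_hasSurjectiveModNGaloisRep
      hp2 C hC hsurj
  haveI : NeZero p := ⟨(Fact.out : p.Prime).ne_zero⟩
  haveI : IsCyclotomicExtension {p} ℚ (CyclotomicField p ℚ) :=
    CyclotomicField.isCyclotomicExtension p ℚ
  haveI : (galRange (K := ℚ) (CyclotomicField p ℚ)).Normal := normal_galRange_cyclotomic p _
  obtain ⟨θ, ηq, -, -, -, hηK, hη1⟩ := exists_theta_eta_cyclotomicField p hp2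
  obtain ⟨γ', hγ'K, hγ', hγ'c, Dη, ⟨e⟩⟩ :=
    exists_etaDatum_prod_linearEquiv_of_decomposition (CyclotomicField p ℚ) ηq
      (fun κ₁ γ₁ hκ₁ hγ₁ hγ₁K hγ₁c F₁ _ _ V₁ _ κF₁ γF₁ hF₁ hθ₁ hC₁ hκF₁ hγF₁ hζ₁ =>
        etaDescentFrame_proof p hp5 (CyclotomicField p ℚ) ηq hηK hη1 V hgood hap κ₁ γ₁ hκ₁ hγ₁ hγ₁K
          hγ₁c F₁ V₁ κF₁ γF₁ hF₁ hθ₁ hC₁ hκF₁ hγF₁ hζ₁)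
      F V' hF hθ hC hκ hγ hγc hκF hγF hζ D DF
  obtain ⟨hDfin, hDtor⟩ := h12 V p hp2 hgood hap κ γ hκ hγ 1 D
  -- Thm. 2.2 and Thm. 4.1 at `η` for `Dη` in `ι`-form (§5), through the Literature promotion copy of the `η`-object
  let Dη' : Kobayashi2003.EtaSignedSelmerDualData V κ (CyclotomicField p ℚ) ℚ_[p] ηq γ' 1 :=
    { X := Dη.X
      conj_mem := Dη.conj_mem
      toDual := Dη.toDual
      bijective := Dη.bijective
      toDual_T_smul := Dη.toDual_T_smul
      toDual_C_smul := Dη.toDual_C_smul }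
  obtain ⟨hηfin, hηtor, ⟨n, hn⟩, hint⟩ :=
    etaKatoDivisibilityInvol_of_zetaContra_of_thm13_4Contra hZc h134c (CyclotomicField p ℚ) ηq hηK hη1 V hv
      hp2 hgood hap hf ϖ hϖ Lη hL κ γ' hκ hγ' hγ'K hγ'c Dη'
  haveI : Module.Finite (IwasawaAlgebra p) D.X := hDfin
  haveI : Module.Finite (IwasawaAlgebra p) Dη.X := hηfin
  have hPtor : Module.IsTorsion (IwasawaAlgebra p) (D.X × Dη.X) :=
    isTorsion_prod_of_isTorsion hDtor hηtor
  have hPchar : Module.charIdeal (IwasawaAlgebra p) (D.X × Dη.X) =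
      Module.charIdeal (IwasawaAlgebra p) D.X * Module.charIdeal (IwasawaAlgebra p) Dη.X :=
    charIdeal_mul_of_shortExact_holds p (D.X × Dη.X) hPtor
      (LinearMap.inl (IwasawaAlgebra p) D.X Dη.X) (LinearMap.snd (IwasawaAlgebra p) D.X Dη.X)
      LinearMap.inl_injective LinearMap.snd_surjective .inl_snd
  have htorF : Module.IsTorsion (IwasawaAlgebra p) DF.X := by
    intro x
    obtain ⟨a, ha⟩ := @hPtor (e x)
    refine ⟨a, ?_⟩
    rw [Submonoid.smul_def] at ha ⊢
    have h := congrArg e.symm ha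
    rwa [map_smul, map_zero, LinearEquiv.symm_apply_apply] at h
  have hcharF : DF.charIdeal = D.charIdeal * Dη.charIdeal := by
    change Module.charIdeal (IwasawaAlgebra p) DF.X =
      Module.charIdeal (IwasawaAlgebra p) D.X * Module.charIdeal (IwasawaAlgebra p) Dη.X
    rw [Module.charIdeal_eq_of_linearEquiv e]
    exact hPchar
  refine ⟨Module.Finite.equiv e.symm, htorF, ⟨n, ?_⟩, fun hsurj' => ?_⟩
  · rw [hcharF, mul_left_comm, Ideal.span_singleton_mul_span_singleton]
    exact Ideal.mul_mono_right ((Ideal.span_singleton_le_iff_mem _).mpr hn)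
  · rw [hcharF]
    exact Ideal.mul_mono_right ((Ideal.span_singleton_le_iff_mem _).mpr (hint hsurj'))

end Row

/-! ## §2 The BY-NAME producer of the re-keyed crux: `{hZ′, Q73′, h12}` ⟹ (RK⁺)^ι on the tower-onto rows -/

/-- **K8's Kato side PRINT-EXACT, BY NAME: the three named Literature facts `hZ′`
(`Kobayashi2003.thm62_63_73_etaColemanPoitouTate_zeta_contra`, p608027), Q73′
(`Kato2004.thm13_4_lengthAt_fineSelmerDualContra_le_of_isEulerSystemClass`, p600084) and `h12`
(`Kobayashi2003.thm12_signedSelmerDual_finite_torsion`) give (RK⁺)^ι `Additive.QuadraticBranchPlusKatoDivisibilityIotaAt V p` for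
every globally minimal `V/ℚ`, `p ≥ 5` good with `a_p = 0` and `ρ̄_{V,p^m}` onto for all `m`** — one line over §1. Its TYPE is the
planner's `ProducerUnfolded` (kit `plan/rekey-20445-g27/Sketch_K8Iota_g27.lean` S2c), definitionally the unfolded glue
`child₁ → child₂ → child₃ → PlusKatoDivisibilityBranchOntoIota` of the re-keyed K8 crux; CONDITIONAL on exactly these three
print-exact facts; closes nothing by itself (the glue item is closed by a one-liner importing the route file). No functional
equation of `L_p⁺(V, η, X)`, no `ι`-symmetry hypothesis — zero new Literature debt.
[cite: Kobayashi2003, Thm. 4.1 (p. 8), Thm. 2.2 (p. 5), Thm. 1.2 (p. 2), Def. 2.1 (p. 5), last sentence of §7 (p. 13)]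
[cite: Kato2004Asterisque, Thm. 13.4 (p. 226), (12.5.2) (p. 222)] [cite: Greenberg1989, pp. 101–102 (S^ι)] -/
theorem plusKatoDivisibilityBranchOntoIota_ofNamedFactsContra
    (hZc : Kobayashi2003.thm62_63_73_etaColemanPoitouTate_zeta_contra)
    (h134c : Kato2004.thm13_4_lengthAt_fineSelmerDualContra_le_of_isEulerSystemClass)
    (h12 : Kobayashi2003.thm12_signedSelmerDual_finite_torsion) :
    ∀ (V : WeierstrassCurve ℚ) [V.IsElliptic] [V.IsGloballyMinimal] (p : ℕ) [Fact p.Prime], 5 ≤ p →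
      V.HasGoodReductionAtPrime p → V.frobeniusTrace p = 0 →
      (∀ m : ℕ, V.HasSurjectiveModNGaloisRep (p ^ m : ℕ)) →
      Summit.BirchSwinnertonDyer.Rank1Residual.Additive.QuadraticBranchPlusKatoDivisibilityIotaAt V p := by
  intro V _ _ p _ hp5 hgood hap hsurj F _ _ V' _ κ γ κF γF N _ f _ _ _ hF hθ hC hκ hγ hγc hκF hγF hζ hf ϖ hϖ Lη hL
    D DF
  exact quadraticBranchPlusKatoDivisibilityIota_row_of_zetaContra_of_thm13_4Contra_of_thm12 hZc h134c h12 V hp5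
    hgood hap hsurj F V' hF hθ hC hκ hγ hγc hκF hγF hζ hf ϖ hϖ Lη hL D DF

end KatoSideIotaContra

end Summit.BirchSwinnertonDyer.BirchSwinnertonDyer.Theorems

end
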